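import Summits.HodgeConjecture.HodgeConjecture.Theorems.Ring2WeilCoverageNonPrincipalLatticeLevel39
import Summits.HodgeConjecture.HodgeConjecture.Theorems.Ring2WeilCoverageNonPrincipalLatticeLevel56
import HarnessLib

/-!
# Weil-type family coverage — the six census rows at the index-2 levels `39/56` ON THE NON-PRINCIPAL LATTICE: for a
# `K`-balanced CM type, `ℂ^Φ/Φ(𝔔)` (`M = 39`) resp. `ℂ^Φ/Φ(𝔓)` (`M = 56`) is principally polarisable iff `n₊₋(Φ)` has the
# OPPOSITE parity to the principal-lattice row of part 41 — so every `K`-balanced type is principally polarisable on exactly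
# one of the two lattices

research route conditional on HC_CM; not a corollary; Q11.4-sentence-2 already refuted in dim ≥ 3.

Ring 2, WEIL-TYPE FAMILY-COVERAGE CENSUS (`HOME/WEIL-FAMILY-COVERAGE.md` `## b01`, blocks b01.25 (A), b01.39 (D); owner ring2-b01),
part 45 of the `Ring2WeilCoverage*` series — the row bookkeeping for parts 43/44.  Part 41 gives, for `Φ` balanced for `N_K`
(`2|S_Φ ∩ N_K| = |S_Φ|`), «`ℂ^Φ/Φ(ℤ[ζ_M])` principally polarisable ⟺ `n₊₋(Φ) = |S_Φ ∩ C₊ ∩ N_K|` ODD» at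
`(39, ℚ(√−3))`, `(39, ℚ(√−39))`, `(56, ℚ(i))`, `(56, ℚ(√−2))` and «⟺ EVEN» at `(56, ℚ(√−7))`, `(56, ℚ(√−14))`; parts 43/44 give
«`ℂ^Φ/Φ(𝔔)` resp. `ℂ^Φ/Φ(𝔓)` principally polarisable ⟺ both twisted counts ODD» for every `Φ`.  Here:

* §0 `card_inter_nodd_mod_two`: `|S ∩ N_odd| ≡ |S ∩ N_K| + |N_odd ∖ N_K| (mod 2)` (part 35's pair count with `C =` all
  residues); for a `K`-balanced `Φ` at these rows `|S_Φ ∩ N_K| = 6` and `|N_odd ∖ N_K| ∈ {8, 4, 6, 6, 8, 6}`, so the two twisted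
  counts `|S_Φ ∩ N_odd ∩ C₊| + |S_Φ ∩ N_odd ∖ C₊| = |S_Φ ∩ N_odd|` have the SAME parity.
* §1–§2 the rows: **`principal_nonprincipal_iff_even_thirtyNine_sqrt_neg_three/_thirtyNine`**,
  **`principal_nonprincipal_iff_even_fiftySix_sqrt_neg_one/_two`**, **`principal_nonprincipal_iff_odd_fiftySix_sqrt_neg_seven/
  _fourteen`**: for `K`-balanced `Φ` and the lattice `𝔪 = 𝔔` resp. `𝔓`, `ℂ^Φ/D(𝔪)` carries an `ι`-compatible principal
  polarisation **iff `n₊₋(Φ)` is EVEN** (first four rows) resp. **ODD** (last two) — the principal-lattice row negated.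
  Consequently (census words): at each of the six `(M, K)` rows EVERY `K`-balanced CM type (all `924` of them; `472 + 452`) is
  the type of a principally polarised simple CM abelian variety of Weil type with CM by `ℤ[ζ_M]`, on exactly one of the two
  lattices `ℤ[ζ_M]`, `𝔔`/`𝔓` (`h(ℚ(ζ_M)) = 2` [Washington1997, tables §11]: these are all the lattice classes — not proved here).

* §3 `exists_pos_isOfType_iff_of_totallyPositive` (general CM field): `𝔪𝔪^ρ = (α)` with `α ≫ 0` ⇒ the verdict of `𝔪` IS the
  verdict of `𝔬` — the case of the census's other `h > 1` levels `52/72`, whose three lattice classes all have totally positive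
  norm generators (`h = 3` odd, `h⁺ = 1` [Washington1997, tables §11]; census b01.40 (C); not proved here).

HONEST FRAMING: statements about Shimura's divisors of principal type on `ℂ^Φ/D(𝔪)`; nothing about Hodge classes, `W_K`, general
members or HC; `HC_CM` is used nowhere.  No `def`, no named fact, no `sorry`.  References: [cite: Shimura1998, §14.3 Prop. 4–5,
pp. 103–104; §14.4 Prop. 7, p. 105]; census b01.25 (A), b01.39 (D) (seat-derived).
-/

noncomputable section

open Polynomial NumberField NumberField.ComplexEmbedding Complex Finset FractionalIdeal
open scoped nonZeroDivisors Real

namespace Summit.HodgeConjecture.Ring2WeilCoverage.NonPrincipalLatticeRows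

open Literature.AlgebraicGeometry.Motives (CMType)
open Literature.AlgebraicGeometry.HodgeTheory (IsCMTypeSet)
open Literature.AlgebraicGeometry.ComplexMultiplication.CyclotomicCMType
open Literature.NumberTheory.ComplexMultiplication
open Summit.HodgeConjecture.Ring2WeilCoverage.CyclotomicTwistedObstruction (card_inter_mod_two_eq_on)
open Summit.HodgeConjecture.Ring2WeilCoverage.CMTypeSetOddPositions (two_mul_card_eq_card_units)
open Summit.HodgeConjecture.Ring2WeilCoverage.CyclotomicTwistedLevel39 (nodd_thirtyNine_eq)
open Summit.HodgeConjecture.Ring2WeilCoverage.CyclotomicTwistedLevel56 (nodd_fiftySix_eq)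
open Summit.HodgeConjecture.Ring2WeilCoverage.CyclotomicTwistedLevelsIff
open Summit.HodgeConjecture.Ring2WeilCoverage.NonPrincipalLatticeLevel39 (principal_iff_odd_thirtyNine_nonprincipal)
open Summit.HodgeConjecture.Ring2WeilCoverage.NonPrincipalLatticeLevel56 (principal_iff_odd_fiftySix_nonprincipal)

variable {K : Type} [Field K] [NumberField K] [IsCMField K] {ζ : K}

/-- `𝐞(t)` (`ZMod.toCircle`). -/
local notation3 (prettyPrint := false) "𝐞 " t:max => ((ZMod.toCircle t : Circle) : ℂ)
/-- `N_odd` at `39` as a filter. -/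
local notation3 (prettyPrint := false) "Nodd39" =>
  (Finset.univ.filter fun t : ZMod 39 => t.val.Coprime 39 ∧
    Even (Finset.card (Finset.filter (fun s : ZMod 39 => s.val.Coprime 39 ∧ s.val < t.val) Finset.univ)))
/-- `N_odd` at `56` as a filter. -/
local notation3 (prettyPrint := false) "Nodd56" =>
  (Finset.univ.filter fun t : ZMod 56 => t.val.Coprime 56 ∧
    Even (Finset.card (Finset.filter (fun s : ZMod 56 => s.val.Coprime 56 ∧ s.val < t.val) Finset.univ)))
/-- `C₊` at `39`. -/
local notation3 (prettyPrint := false) "Cp39" => ({1, 4, 10, 14, 16, 17, 22, 23, 25, 29, 35, 38} : Finset (ZMod 39))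
/-- `C₊` at `56`. -/
local notation3 (prettyPrint := false) "Cp56" => ({1, 9, 15, 17, 23, 25, 31, 33, 39, 41, 47, 55} : Finset (ZMod 56))
/-- the lattice `𝔔 = (1 − ζ³, 4 + ζ¹³)` at `39`. -/
local notation3 (prettyPrint := false) "𝔔[" hζ "]" =>
  (Ideal.span {1 - IsPrimitiveRoot.toInteger hζ ^ 3, 4 + IsPrimitiveRoot.toInteger hζ ^ 13} : Ideal (𝓞 K))
/-- the lattice `𝔓 = (1 − ζ⁷, ζ⁸ + ζ¹⁶ + ζ³²)` at `56`. -/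
local notation3 (prettyPrint := false) "𝔓[" hζ "]" =>
  (Ideal.span {1 - IsPrimitiveRoot.toInteger hζ ^ 7,
    IsPrimitiveRoot.toInteger hζ ^ 8 + IsPrimitiveRoot.toInteger hζ ^ 16 + IsPrimitiveRoot.toInteger hζ ^ 32} : Ideal (𝓞 K))

/-! ### §0 The two twisted counts of a `K`-balanced type have the same parity -/

/-- **`|S ∩ N_odd| ≡ |S ∩ N_K| + |N_odd ∖ N_K| (mod 2)`** for CM-type sets `S, N_odd, N_K` (part 35's pair count over all
residues).
research route conditional on HC_CM; not a corollary; Q11.4-sentence-2 already refuted in dim ≥ 3. [folklore] -/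
theorem card_inter_nodd_mod_two {m : ℕ} [NeZero m] {S Nodd NK : Finset (ZMod m)} (hS : IsCMTypeSet m S)
    (hNodd : IsCMTypeSet m Nodd) (hNK : IsCMTypeSet m NK) :
    (S ∩ Nodd).card % 2 = ((S ∩ NK).card + (Nodd \ NK).card) % 2 := by
  have h := card_inter_mod_two_eq_on hS hNodd hNK (C := Finset.univ) (fun t _ => Finset.mem_univ _)
  simpa only [Finset.inter_univ, Finset.univ_inter] using h

/-- Row data (`decide`): the CM-type sets `N_odd` (both levels) and the six `N_K`; `|N_odd ∖ N_K| = 8, 4, 6, 6, 8, 6`;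
`|(ℤ/39)ˣ| = |(ℤ/56)ˣ| = 24`. [folklore] -/
theorem rowData :
    IsCMTypeSet 39 ({1, 4, 7, 10, 14, 17, 20, 23, 28, 31, 34, 37} : Finset (ZMod 39)) ∧
    IsCMTypeSet 56 ({1, 5, 11, 15, 19, 25, 29, 33, 39, 43, 47, 53} : Finset (ZMod 56)) ∧
    (IsCMTypeSet 39 ({2, 5, 8, 11, 14, 17, 20, 23, 29, 32, 35, 38} : Finset (ZMod 39)) ∧
      (({1, 4, 7, 10, 14, 17, 20, 23, 28, 31, 34, 37} : Finset (ZMod 39)) \ ({2, 5, 8, 11, 14, 17, 20, 23, 29, 32, 35, 38} : Finset (ZMod 39))).card = 8) ∧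
    (IsCMTypeSet 39 ({7, 14, 17, 19, 23, 28, 29, 31, 34, 35, 37, 38} : Finset (ZMod 39)) ∧
      (({1, 4, 7, 10, 14, 17, 20, 23, 28, 31, 34, 37} : Finset (ZMod 39)) \ ({7, 14, 17, 19, 23, 28, 29, 31, 34, 35, 37, 38} : Finset (ZMod 39))).card = 4) ∧
    (IsCMTypeSet 56 ({3, 11, 15, 19, 23, 27, 31, 39, 43, 47, 51, 55} : Finset (ZMod 56)) ∧
      (({1, 5, 11, 15, 19, 25, 29, 33, 39, 43, 47, 53} : Finset (ZMod 56)) \ ({3, 11, 15, 19, 23, 27, 31, 39, 43, 47, 51, 55} : Finset (ZMod 56))).card = 6) ∧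
    (IsCMTypeSet 56 ({5, 13, 15, 23, 29, 31, 37, 39, 45, 47, 53, 55} : Finset (ZMod 56)) ∧
      (({1, 5, 11, 15, 19, 25, 29, 33, 39, 43, 47, 53} : Finset (ZMod 56)) \ ({5, 13, 15, 23, 29, 31, 37, 39, 45, 47, 53, 55} : Finset (ZMod 56))).card = 6) ∧
    (IsCMTypeSet 56 ({3, 5, 13, 17, 19, 27, 31, 33, 41, 45, 47, 55} : Finset (ZMod 56)) ∧
      (({1, 5, 11, 15, 19, 25, 29, 33, 39, 43, 47, 53} : Finset (ZMod 56)) \ ({3, 5, 13, 17, 19, 27, 31, 33, 41, 45, 47, 55} : Finset (ZMod 56))).card = 8) ∧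
    (IsCMTypeSet 56 ({11, 17, 29, 31, 33, 37, 41, 43, 47, 51, 53, 55} : Finset (ZMod 56)) ∧
      (({1, 5, 11, 15, 19, 25, 29, 33, 39, 43, 47, 53} : Finset (ZMod 56)) \ ({11, 17, 29, 31, 33, 37, 41, 43, 47, 51, 53, 55} : Finset (ZMod 56))).card = 6) ∧
    (Finset.univ.filter fun t : ZMod 39 => t.val.Coprime 39).card = 24 ∧
    (Finset.univ.filter fun t : ZMod 56 => t.val.Coprime 56).card = 24 := by
  refine ⟨by decide, by decide, ⟨by decide, by decide⟩, ⟨by decide, by decide⟩, ⟨by decide, by decide⟩,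
    ⟨by decide, by decide⟩, ⟨by decide, by decide⟩, ⟨by decide, by decide⟩, by decide, by decide⟩

/-! ### §1 The two rows at `39` on `𝔔` -/

open scoped Classical in
/-- **ROW `(39, ℚ(√−3))` ON `𝔔`**: for a CM type `Φ` balanced for `N_K = {2, 5, 8, 11, 14, 17, 20, 23, 29, 32, 35, 38}`, the torus `ℂ^Φ/Φ(𝔔)`
(`𝔔 = (1 − ζ³, 4 + ζ¹³)`) carries an `ι`-compatible principal polarisation **iff `n₊₋(Φ) = |S_Φ ∩ {14, 17, 23, 29, 35, 38}|` is EVEN** — the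
principal-lattice row `principal_iff_odd_thirtyNine_sqrt_neg_three` (part 41) negated.
research route conditional on HC_CM; not a corollary; Q11.4-sentence-2 already refuted in dim ≥ 3. [cite: Shimura1998, §14.3 Prop. 4–5, pp. 103–104; §14.4 Prop. 7, p. 105] -/
theorem principal_nonprincipal_iff_even_thirtyNine_sqrt_neg_three [IsCyclotomicExtension {39} ℚ K] (hζ : IsPrimitiveRoot ζ 39)
    (Φ : CMType K)
    (hbal : 2 * ((Finset.univ.filter fun t : ZMod 39 => ∃ σ ∈ Φ.1, σ ζ = 𝐞 t) ∩ ({2, 5, 8, 11, 14, 17, 20, 23, 29, 32, 35, 38} : Finset (ZMod 39))).card =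
      (Finset.univ.filter fun t : ZMod 39 => ∃ σ ∈ Φ.1, σ ζ = 𝐞 t).card)
    (𝔪 : (FractionalIdeal (𝓞 K)⁰ K)ˣ)
    (h𝔪 : (𝔪 : FractionalIdeal (𝓞 K)⁰ K) = ((𝔔[hζ] : Ideal (𝓞 K)) : FractionalIdeal (𝓞 K)⁰ K)) :
    (∃ ζ' : K, IsCMField.complexConj K ζ' = -ζ' ∧ (∀ φ : Φ.1, 0 < (φ.1 ζ').im) ∧
        CMTypeLattice.IsOfType 𝔪 ζ' ⊤) ↔
      Even (((Finset.univ.filter fun t : ZMod 39 => ∃ σ ∈ Φ.1, σ ζ = 𝐞 t) ∩ ({14, 17, 23, 29, 35, 38} : Finset (ZMod 39))).card) := by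
  classical
  obtain ⟨hNodd, -, ⟨hNK, hc⟩, -, -, -, -, -, hU, -⟩ := rowData
  have hS := isCMTypeSet_residueFilter hζ Φ
  have key := (principal_iff_thirtyNine hζ Φ).symm.trans (principal_iff_odd_thirtyNine_sqrt_neg_three hζ Φ hbal)
  have hsum := Finset.card_filter_add_card_filter_not
    (s := (Finset.univ.filter fun t : ZMod 39 => ∃ σ ∈ Φ.1, σ ζ = 𝐞 t) ∩ Nodd39) (p := fun t => t ∈ Cp39)
  have hcard : (Finset.univ.filter fun t : ZMod 39 => ∃ σ ∈ Φ.1, σ ζ = 𝐞 t).card = 12 := by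
    have := two_mul_card_eq_card_units hS; omega
  have hpar : (((Finset.univ.filter fun t : ZMod 39 => ∃ σ ∈ Φ.1, σ ζ = 𝐞 t) ∩ Nodd39).card) % 2 = 0 := by
    rw [nodd_thirtyNine_eq, card_inter_nodd_mod_two hS hNodd hNK, hc]; omega
  rw [principal_iff_odd_thirtyNine_nonprincipal hζ Φ 𝔪 h𝔪]
  rw [Nat.even_iff, Nat.even_iff, Nat.odd_iff] at key
  rw [Nat.odd_iff, Nat.odd_iff, Nat.even_iff]
  omega

open scoped Classical in
/-- **ROW `(39, ℚ(√−39))` ON `𝔔`**: for a CM type `Φ` balanced for `N_K = {7, 14, 17, 19, 23, 28, 29, 31, 34, 35, 37, 38}`, the torus `ℂ^Φ/Φ(𝔔)`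
(`𝔔 = (1 − ζ³, 4 + ζ¹³)`) carries an `ι`-compatible principal polarisation **iff `n₊₋(Φ) = |S_Φ ∩ {14, 17, 23, 29, 35, 38}|` is EVEN** — the
principal-lattice row `principal_iff_odd_thirtyNine_sqrt_neg_thirtyNine` (part 41) negated.
research route conditional on HC_CM; not a corollary; Q11.4-sentence-2 already refuted in dim ≥ 3. [cite: Shimura1998, §14.3 Prop. 4–5, pp. 103–104; §14.4 Prop. 7, p. 105] -/
theorem principal_nonprincipal_iff_even_thirtyNine_sqrt_neg_thirtyNine [IsCyclotomicExtension {39} ℚ K] (hζ : IsPrimitiveRoot ζ 39)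
    (Φ : CMType K)
    (hbal : 2 * ((Finset.univ.filter fun t : ZMod 39 => ∃ σ ∈ Φ.1, σ ζ = 𝐞 t) ∩ ({7, 14, 17, 19, 23, 28, 29, 31, 34, 35, 37, 38} : Finset (ZMod 39))).card =
      (Finset.univ.filter fun t : ZMod 39 => ∃ σ ∈ Φ.1, σ ζ = 𝐞 t).card)
    (𝔪 : (FractionalIdeal (𝓞 K)⁰ K)ˣ)
    (h𝔪 : (𝔪 : FractionalIdeal (𝓞 K)⁰ K) = ((𝔔[hζ] : Ideal (𝓞 K)) : FractionalIdeal (𝓞 K)⁰ K)) :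
    (∃ ζ' : K, IsCMField.complexConj K ζ' = -ζ' ∧ (∀ φ : Φ.1, 0 < (φ.1 ζ').im) ∧
        CMTypeLattice.IsOfType 𝔪 ζ' ⊤) ↔
      Even (((Finset.univ.filter fun t : ZMod 39 => ∃ σ ∈ Φ.1, σ ζ = 𝐞 t) ∩ ({14, 17, 23, 29, 35, 38} : Finset (ZMod 39))).card) := by
  classical
  obtain ⟨hNodd, -, -, ⟨hNK, hc⟩, -, -, -, -, hU, -⟩ := rowData
  have hS := isCMTypeSet_residueFilter hζ Φ
  have key := (principal_iff_thirtyNine hζ Φ).symm.trans (principal_iff_odd_thirtyNine_sqrt_neg_thirtyNine hζ Φ hbal)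
  have hsum := Finset.card_filter_add_card_filter_not
    (s := (Finset.univ.filter fun t : ZMod 39 => ∃ σ ∈ Φ.1, σ ζ = 𝐞 t) ∩ Nodd39) (p := fun t => t ∈ Cp39)
  have hcard : (Finset.univ.filter fun t : ZMod 39 => ∃ σ ∈ Φ.1, σ ζ = 𝐞 t).card = 12 := by
    have := two_mul_card_eq_card_units hS; omega
  have hpar : (((Finset.univ.filter fun t : ZMod 39 => ∃ σ ∈ Φ.1, σ ζ = 𝐞 t) ∩ Nodd39).card) % 2 = 0 := by
    rw [nodd_thirtyNine_eq, card_inter_nodd_mod_two hS hNodd hNK, hc]; omega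
  rw [principal_iff_odd_thirtyNine_nonprincipal hζ Φ 𝔪 h𝔪]
  rw [Nat.even_iff, Nat.even_iff, Nat.odd_iff] at key
  rw [Nat.odd_iff, Nat.odd_iff, Nat.even_iff]
  omega

/-! ### §2 The four rows at `56` on `𝔓` -/

open scoped Classical in
/-- **ROW `(56, ℚ(i))` ON `𝔓`**: for a CM type `Φ` balanced for `N_K = {3, 11, 15, 19, 23, 27, 31, 39, 43, 47, 51, 55}`, the torus `ℂ^Φ/Φ(𝔓)`
(`𝔓 = (1 − ζ⁷, ζ⁸ + ζ¹⁶ + ζ³²)`) carries an `ι`-compatible principal polarisation **iff `n₊₋(Φ) = |S_Φ ∩ {15, 23, 31, 39, 47, 55}|` is EVEN** — the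
principal-lattice row `principal_iff_odd_fiftySix_sqrt_neg_one` (part 41) negated.
research route conditional on HC_CM; not a corollary; Q11.4-sentence-2 already refuted in dim ≥ 3. [cite: Shimura1998, §14.3 Prop. 4–5, pp. 103–104; §14.4 Prop. 7, p. 105] -/
theorem principal_nonprincipal_iff_even_fiftySix_sqrt_neg_one [IsCyclotomicExtension {56} ℚ K] (hζ : IsPrimitiveRoot ζ 56)
    (Φ : CMType K)
    (hbal : 2 * ((Finset.univ.filter fun t : ZMod 56 => ∃ σ ∈ Φ.1, σ ζ = 𝐞 t) ∩ ({3, 11, 15, 19, 23, 27, 31, 39, 43, 47, 51, 55} : Finset (ZMod 56))).card =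
      (Finset.univ.filter fun t : ZMod 56 => ∃ σ ∈ Φ.1, σ ζ = 𝐞 t).card)
    (𝔪 : (FractionalIdeal (𝓞 K)⁰ K)ˣ)
    (h𝔪 : (𝔪 : FractionalIdeal (𝓞 K)⁰ K) = ((𝔓[hζ] : Ideal (𝓞 K)) : FractionalIdeal (𝓞 K)⁰ K)) :
    (∃ ζ' : K, IsCMField.complexConj K ζ' = -ζ' ∧ (∀ φ : Φ.1, 0 < (φ.1 ζ').im) ∧
        CMTypeLattice.IsOfType 𝔪 ζ' ⊤) ↔
      Even (((Finset.univ.filter fun t : ZMod 56 => ∃ σ ∈ Φ.1, σ ζ = 𝐞 t) ∩ ({15, 23, 31, 39, 47, 55} : Finset (ZMod 56))).card) := by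
  classical
  obtain ⟨-, hNodd, -, -, ⟨hNK, hc⟩, -, -, -, -, hU⟩ := rowData
  have hS := isCMTypeSet_residueFilter hζ Φ
  have key := (principal_iff_fiftySix hζ Φ).symm.trans (principal_iff_odd_fiftySix_sqrt_neg_one hζ Φ hbal)
  have hsum := Finset.card_filter_add_card_filter_not
    (s := (Finset.univ.filter fun t : ZMod 56 => ∃ σ ∈ Φ.1, σ ζ = 𝐞 t) ∩ Nodd56) (p := fun t => t ∈ Cp56)
  have hcard : (Finset.univ.filter fun t : ZMod 56 => ∃ σ ∈ Φ.1, σ ζ = 𝐞 t).card = 12 := by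
    have := two_mul_card_eq_card_units hS; omega
  have hpar : (((Finset.univ.filter fun t : ZMod 56 => ∃ σ ∈ Φ.1, σ ζ = 𝐞 t) ∩ Nodd56).card) % 2 = 0 := by
    rw [nodd_fiftySix_eq, card_inter_nodd_mod_two hS hNodd hNK, hc]; omega
  rw [principal_iff_odd_fiftySix_nonprincipal hζ Φ 𝔪 h𝔪]
  rw [Nat.even_iff, Nat.even_iff, Nat.odd_iff] at key
  rw [Nat.odd_iff, Nat.odd_iff, Nat.even_iff]
  omega

open scoped Classical in
/-- **ROW `(56, ℚ(√−2))` ON `𝔓`**: for a CM type `Φ` balanced for `N_K = {5, 13, 15, 23, 29, 31, 37, 39, 45, 47, 53, 55}`, the torus `ℂ^Φ/Φ(𝔓)`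
(`𝔓 = (1 − ζ⁷, ζ⁸ + ζ¹⁶ + ζ³²)`) carries an `ι`-compatible principal polarisation **iff `n₊₋(Φ) = |S_Φ ∩ {15, 23, 31, 39, 47, 55}|` is EVEN** — the
principal-lattice row `principal_iff_odd_fiftySix_sqrt_neg_two` (part 41) negated.
research route conditional on HC_CM; not a corollary; Q11.4-sentence-2 already refuted in dim ≥ 3. [cite: Shimura1998, §14.3 Prop. 4–5, pp. 103–104; §14.4 Prop. 7, p. 105] -/
theorem principal_nonprincipal_iff_even_fiftySix_sqrt_neg_two [IsCyclotomicExtension {56} ℚ K] (hζ : IsPrimitiveRoot ζ 56)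
    (Φ : CMType K)
    (hbal : 2 * ((Finset.univ.filter fun t : ZMod 56 => ∃ σ ∈ Φ.1, σ ζ = 𝐞 t) ∩ ({5, 13, 15, 23, 29, 31, 37, 39, 45, 47, 53, 55} : Finset (ZMod 56))).card =
      (Finset.univ.filter fun t : ZMod 56 => ∃ σ ∈ Φ.1, σ ζ = 𝐞 t).card)
    (𝔪 : (FractionalIdeal (𝓞 K)⁰ K)ˣ)
    (h𝔪 : (𝔪 : FractionalIdeal (𝓞 K)⁰ K) = ((𝔓[hζ] : Ideal (𝓞 K)) : FractionalIdeal (𝓞 K)⁰ K)) :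
    (∃ ζ' : K, IsCMField.complexConj K ζ' = -ζ' ∧ (∀ φ : Φ.1, 0 < (φ.1 ζ').im) ∧
        CMTypeLattice.IsOfType 𝔪 ζ' ⊤) ↔
      Even (((Finset.univ.filter fun t : ZMod 56 => ∃ σ ∈ Φ.1, σ ζ = 𝐞 t) ∩ ({15, 23, 31, 39, 47, 55} : Finset (ZMod 56))).card) := by
  classical
  obtain ⟨-, hNodd, -, -, -, ⟨hNK, hc⟩, -, -, -, hU⟩ := rowData
  have hS := isCMTypeSet_residueFilter hζ Φ
  have key := (principal_iff_fiftySix hζ Φ).symm.trans (principal_iff_odd_fiftySix_sqrt_neg_two hζ Φ hbal)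
  have hsum := Finset.card_filter_add_card_filter_not
    (s := (Finset.univ.filter fun t : ZMod 56 => ∃ σ ∈ Φ.1, σ ζ = 𝐞 t) ∩ Nodd56) (p := fun t => t ∈ Cp56)
  have hcard : (Finset.univ.filter fun t : ZMod 56 => ∃ σ ∈ Φ.1, σ ζ = 𝐞 t).card = 12 := by
    have := two_mul_card_eq_card_units hS; omega
  have hpar : (((Finset.univ.filter fun t : ZMod 56 => ∃ σ ∈ Φ.1, σ ζ = 𝐞 t) ∩ Nodd56).card) % 2 = 0 := by
    rw [nodd_fiftySix_eq, card_inter_nodd_mod_two hS hNodd hNK, hc]; omega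
  rw [principal_iff_odd_fiftySix_nonprincipal hζ Φ 𝔪 h𝔪]
  rw [Nat.even_iff, Nat.even_iff, Nat.odd_iff] at key
  rw [Nat.odd_iff, Nat.odd_iff, Nat.even_iff]
  omega

open scoped Classical in
/-- **ROW `(56, ℚ(√−7))` ON `𝔓`**: for a CM type `Φ` balanced for `N_K = {3, 5, 13, 17, 19, 27, 31, 33, 41, 45, 47, 55}`, the torus `ℂ^Φ/Φ(𝔓)`
(`𝔓 = (1 − ζ⁷, ζ⁸ + ζ¹⁶ + ζ³²)`) carries an `ι`-compatible principal polarisation **iff `n₊₋(Φ) = |S_Φ ∩ {17, 31, 33, 41, 47, 55}|` is ODD** — the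
principal-lattice row `principal_iff_even_fiftySix_sqrt_neg_seven` (part 41) negated.
research route conditional on HC_CM; not a corollary; Q11.4-sentence-2 already refuted in dim ≥ 3. [cite: Shimura1998, §14.3 Prop. 4–5, pp. 103–104; §14.4 Prop. 7, p. 105] -/
theorem principal_nonprincipal_iff_odd_fiftySix_sqrt_neg_seven [IsCyclotomicExtension {56} ℚ K] (hζ : IsPrimitiveRoot ζ 56)
    (Φ : CMType K)
    (hbal : 2 * ((Finset.univ.filter fun t : ZMod 56 => ∃ σ ∈ Φ.1, σ ζ = 𝐞 t) ∩ ({3, 5, 13, 17, 19, 27, 31, 33, 41, 45, 47, 55} : Finset (ZMod 56))).card =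
      (Finset.univ.filter fun t : ZMod 56 => ∃ σ ∈ Φ.1, σ ζ = 𝐞 t).card)
    (𝔪 : (FractionalIdeal (𝓞 K)⁰ K)ˣ)
    (h𝔪 : (𝔪 : FractionalIdeal (𝓞 K)⁰ K) = ((𝔓[hζ] : Ideal (𝓞 K)) : FractionalIdeal (𝓞 K)⁰ K)) :
    (∃ ζ' : K, IsCMField.complexConj K ζ' = -ζ' ∧ (∀ φ : Φ.1, 0 < (φ.1 ζ').im) ∧
        CMTypeLattice.IsOfType 𝔪 ζ' ⊤) ↔
      Odd (((Finset.univ.filter fun t : ZMod 56 => ∃ σ ∈ Φ.1, σ ζ = 𝐞 t) ∩ ({17, 31, 33, 41, 47, 55} : Finset (ZMod 56))).card) := by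
  classical
  obtain ⟨-, hNodd, -, -, -, -, ⟨hNK, hc⟩, -, -, hU⟩ := rowData
  have hS := isCMTypeSet_residueFilter hζ Φ
  have key := (principal_iff_fiftySix hζ Φ).symm.trans (principal_iff_even_fiftySix_sqrt_neg_seven hζ Φ hbal)
  have hsum := Finset.card_filter_add_card_filter_not
    (s := (Finset.univ.filter fun t : ZMod 56 => ∃ σ ∈ Φ.1, σ ζ = 𝐞 t) ∩ Nodd56) (p := fun t => t ∈ Cp56)
  have hcard : (Finset.univ.filter fun t : ZMod 56 => ∃ σ ∈ Φ.1, σ ζ = 𝐞 t).card = 12 := by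
    have := two_mul_card_eq_card_units hS; omega
  have hpar : (((Finset.univ.filter fun t : ZMod 56 => ∃ σ ∈ Φ.1, σ ζ = 𝐞 t) ∩ Nodd56).card) % 2 = 0 := by
    rw [nodd_fiftySix_eq, card_inter_nodd_mod_two hS hNodd hNK, hc]; omega
  rw [principal_iff_odd_fiftySix_nonprincipal hζ Φ 𝔪 h𝔪]
  rw [Nat.even_iff, Nat.even_iff, Nat.even_iff] at key
  rw [Nat.odd_iff, Nat.odd_iff, Nat.odd_iff]
  omega

open scoped Classical in
/-- **ROW `(56, ℚ(√−14))` ON `𝔓`**: for a CM type `Φ` balanced for `N_K = {11, 17, 29, 31, 33, 37, 41, 43, 47, 51, 53, 55}`, the torus `ℂ^Φ/Φ(𝔓)`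
(`𝔓 = (1 − ζ⁷, ζ⁸ + ζ¹⁶ + ζ³²)`) carries an `ι`-compatible principal polarisation **iff `n₊₋(Φ) = |S_Φ ∩ {17, 31, 33, 41, 47, 55}|` is ODD** — the
principal-lattice row `principal_iff_even_fiftySix_sqrt_neg_fourteen` (part 41) negated.
research route conditional on HC_CM; not a corollary; Q11.4-sentence-2 already refuted in dim ≥ 3. [cite: Shimura1998, §14.3 Prop. 4–5, pp. 103–104; §14.4 Prop. 7, p. 105] -/
theorem principal_nonprincipal_iff_odd_fiftySix_sqrt_neg_fourteen [IsCyclotomicExtension {56} ℚ K] (hζ : IsPrimitiveRoot ζ 56)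
    (Φ : CMType K)
    (hbal : 2 * ((Finset.univ.filter fun t : ZMod 56 => ∃ σ ∈ Φ.1, σ ζ = 𝐞 t) ∩ ({11, 17, 29, 31, 33, 37, 41, 43, 47, 51, 53, 55} : Finset (ZMod 56))).card =
      (Finset.univ.filter fun t : ZMod 56 => ∃ σ ∈ Φ.1, σ ζ = 𝐞 t).card)
    (𝔪 : (FractionalIdeal (𝓞 K)⁰ K)ˣ)
    (h𝔪 : (𝔪 : FractionalIdeal (𝓞 K)⁰ K) = ((𝔓[hζ] : Ideal (𝓞 K)) : FractionalIdeal (𝓞 K)⁰ K)) :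
    (∃ ζ' : K, IsCMField.complexConj K ζ' = -ζ' ∧ (∀ φ : Φ.1, 0 < (φ.1 ζ').im) ∧
        CMTypeLattice.IsOfType 𝔪 ζ' ⊤) ↔
      Odd (((Finset.univ.filter fun t : ZMod 56 => ∃ σ ∈ Φ.1, σ ζ = 𝐞 t) ∩ ({17, 31, 33, 41, 47, 55} : Finset (ZMod 56))).card) := by
  classical
  obtain ⟨-, hNodd, -, -, -, -, -, ⟨hNK, hc⟩, -, hU⟩ := rowData
  have hS := isCMTypeSet_residueFilter hζ Φ
  have key := (principal_iff_fiftySix hζ Φ).symm.trans (principal_iff_even_fiftySix_sqrt_neg_fourteen hζ Φ hbal)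
  have hsum := Finset.card_filter_add_card_filter_not
    (s := (Finset.univ.filter fun t : ZMod 56 => ∃ σ ∈ Φ.1, σ ζ = 𝐞 t) ∩ Nodd56) (p := fun t => t ∈ Cp56)
  have hcard : (Finset.univ.filter fun t : ZMod 56 => ∃ σ ∈ Φ.1, σ ζ = 𝐞 t).card = 12 := by
    have := two_mul_card_eq_card_units hS; omega
  have hpar : (((Finset.univ.filter fun t : ZMod 56 => ∃ σ ∈ Φ.1, σ ζ = 𝐞 t) ∩ Nodd56).card) % 2 = 0 := by
    rw [nodd_fiftySix_eq, card_inter_nodd_mod_two hS hNodd hNK, hc]; omega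
  rw [principal_iff_odd_fiftySix_nonprincipal hζ Φ 𝔪 h𝔪]
  rw [Nat.even_iff, Nat.even_iff, Nat.even_iff] at key
  rw [Nat.odd_iff, Nat.odd_iff, Nat.odd_iff]
  omega

/-! ### §3 The other `h > 1` levels of the census (`52`, `72`): a totally positive norm generator repeats the principal verdict -/

/-- **Totally positive norm generator ⇒ the verdict of `𝔬`** (general CM field; the case of the levels `52/72`: there
`h(ℚ(ζ_M)) = 3` is ODD and `h(ℚ(ζ_M)⁺) = 1` [Washington1997, tables §11], so the narrow class group of `K⁺` is an elementary
`2`-group and the norm map `Cl(K) → Cl⁺(K⁺)`, `[𝔪] ↦ [𝔪𝔪^ρ ∩ K⁺]`, is trivial: EVERY lattice class has `𝔪𝔪^ρ = (α)` with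
`α ≫ 0` — census b01.40 (C), an input cited as printed and NOT proved here): if `𝔪𝔪^ρ = (α)` with `Re φ(α) > 0` at every
embedding `φ`, then `ℂ^Φ/D(𝔪)` carries a `Φ`-positive divisor of type `𝔣₀` iff `ℂ^Φ/D(𝔬)` does (part 42: `Φ_α = Φ`).
research route conditional on HC_CM; not a corollary; Q11.4-sentence-2 already refuted in dim ≥ 3. [cite: Shimura1998, §14.4 Prop. 7, p. 105] -/
theorem exists_pos_isOfType_iff_of_totallyPositive (Φ : CMType K) (𝔪 : (FractionalIdeal (𝓞 K)⁰ K)ˣ) {α : K}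
    (hα : IsCMField.complexConj K α = α) (hpos : ∀ φ : K →+* ℂ, 0 < (φ α).re)
    (h𝔪 : (𝔪 : FractionalIdeal (𝓞 K)⁰ K) * (CMTypeLattice.conjIdeal 𝔪 : FractionalIdeal (𝓞 K)⁰ K) =
      spanSingleton (𝓞 K)⁰ α) (𝔣₀ : Ideal (𝓞 (maximalRealSubfield K))) :
    (∃ ζ' : K, IsCMField.complexConj K ζ' = -ζ' ∧ (∀ φ : Φ.1, 0 < (φ.1 ζ').im) ∧ CMTypeLattice.IsOfType 𝔪 ζ' 𝔣₀) ↔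
      ∃ ζ' : K, IsCMField.complexConj K ζ' = -ζ' ∧ (∀ φ : Φ.1, 0 < (φ.1 ζ').im) ∧ CMTypeLattice.IsOfType 1 ζ' 𝔣₀ := by
  obtain ⟨φ₀⟩ := (inferInstance : Nonempty (K →+* ℂ))
  have h0 : α ≠ 0 := fun h => by
    have := hpos φ₀
    rw [h, map_zero, Complex.zero_re] at this
    exact lt_irrefl _ this
  obtain ⟨Φ', hΦ'⟩ := LatticeNormTwist.exists_twist Φ hα h0
  rw [LatticeNormTwist.exists_pos_isOfType_iff_twist Φ Φ' hα h0 hΦ' 𝔪 h𝔪 𝔣₀]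
  have hmem := LatticeNormTwist.mem_twist_iff_of_pos Φ Φ' hΦ' hpos
  constructor
  · rintro ⟨ζ', h1, h2, h3⟩
    exact ⟨ζ', h1, fun φ => h2 ⟨φ.1, (hmem φ.1).mpr φ.2⟩, h3⟩
  · rintro ⟨ζ', h1, h2, h3⟩
    exact ⟨ζ', h1, fun φ => h2 ⟨φ.1, (hmem φ.1).mp φ.2⟩, h3⟩

end Summit.HodgeConjecture.Ring2WeilCoverage.NonPrincipalLatticeRows

end
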